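import Mathlib
import Literature.Analysis.FluidPDE.GaussianVortexPlanar
import Literature.Analysis.FluidPDE.GaussianVortexPlanarProofs
import Literature.Analysis.FluidPDE.BiotSavart2DSymmetry
import Literature.Analysis.UnboundedOperators.HeatKernelBoundedData
import HarnessLib

/-!
# Helper `coreBiotSavart_skew` toward stub `stub_coreInverse` of the line `braid-closed-large-circulation-gluing`
# (crux stmt-AnomalousDissipation-3009, `MarginalStabilityChain.StretchedVortexRows`)

The Biot–Savart half of the skew-symmetry of the linearised transport operator
`Λ_G w = v^G·∇w + (K∗w)·∇G` at the Gaussian vortex `G = gaussVortexProfile` in the weighted space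
`X = L²(G⁻¹ dξ)` (Gallay–Wayne 2005, Lemma 4.8; Li–Wei–Zhang 2020, Lemma 2.1):

  `∫ G⁻¹ w ⟪(K∗w)(ξ), ∇G(ξ)⟫ dξ = 0`

for every continuous integrable `w` with a Gaussian bound `|w| ≤ M G`.

Proof. Since `∇G(ξ) = −(G(ξ)/2) ξ` (tree `fderiv_gaussVortexProfile_apply`) the integrand equals
`−½ w(ξ) ⟪ξ, (K∗w)(ξ)⟫`, and moving `⟪ξ, ·⟫` inside the absolutely convergent Biot–Savart integral
(tree `integrable_smul_biotSavartKernel2D`) the claim becomes `J := ∫∫ F = 0` for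
`F(ξ, η) = w(ξ) w(η) ⟪ξ, K(ξ − η)⟫`. The kernel `K(x) = x^⊥/(2π|x|²)` satisfies `⟪x, K(x)⟫ = 0` and is odd, whence
`⟪η, K(η − ξ)⟫ = −⟪ξ, K(ξ − η)⟫` (`inner_biotSavartKernel2D_swap`) and `F(η, ξ) = −F(ξ, η)`. `F` is integrable
on `ℝ² × ℝ²`: `|F(ξ, η)| ≤ |w ξ| |ξ| · ‖w(η) K(ξ − η)‖` and `∫ ‖w(η) K(ξ − η)‖ dη ≤ C` uniformly in `ξ`
(near/far split of the tree lemma `norm_biotSavart_integrand_le`: `|w| ≤ M/(4π)`, `‖z‖⁻¹ ∈ L¹(disc)`, `w ∈ L¹`),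
while `|w ξ| |ξ| ≤ M G(ξ)|ξ|` is integrable (`G = Γ₁`, first moment of the heat kernel). Fubini
(`integral_integral_swap`) then gives `J = −J`.

References: Th. Gallay, C. E. Wayne, Comm. Math. Phys. 255 (2005) 97–129, Lemma 4.8; T. Li, D. Wei, Z. Zhang,
Ann. Sci. ÉNS 53 (2020) = arXiv:1701.06269, Lemma 2.1.
-/

set_option linter.dupNamespace false

noncomputable section

open scoped RealInnerProductSpace Topology Laplacian
open MeasureTheory WithLp Function Filter

namespace Summit.AnomalousDissipation.AnomalousDissipation.Theorems.MarginalStabilityChainStretchedVortexRows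

open Literature.Analysis.FluidPDE

/-- Antisymmetry of the paired Biot–Savart kernel: `⟪η, K(η − ξ)⟫ = −⟪ξ, K(ξ − η)⟫`
(`⟪x, x^⊥⟫ = 0`, `K` odd, `⊥` skew). [folklore] -/
theorem inner_biotSavartKernel2D_swap (ξ η : EuclideanSpace ℝ (Fin 2)) :
    ⟪η, biotSavartKernel2D (η - ξ)⟫ = -⟪ξ, biotSavartKernel2D (ξ - η)⟫ := by
  have h : ⟪η, perp ξ⟫ = -⟪ξ, perp η⟫ := by
    rw [real_inner_comm (perp ξ) η, inner_perp_left]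
  simp only [biotSavartKernel2D, inner_smul_right, perp_sub, inner_sub_right, inner_perp_self_right,
    norm_sub_rev η ξ, h]
  ring

/-- A Gaussian bound `|w| ≤ M G` gives the uniform bound `|w| ≤ |M| (4π)⁻¹`. [folklore] -/
theorem abs_le_of_abs_le_mul_gaussVortexProfile {w : EuclideanSpace ℝ (Fin 2) → ℝ} {M : ℝ}
    (hM : ∀ ξ, |w ξ| ≤ M * gaussVortexProfile ξ) (y : EuclideanSpace ℝ (Fin 2)) :
    |w y| ≤ |M| * (4 * Real.pi)⁻¹ :=
  calc |w y| ≤ M * gaussVortexProfile y := hM y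
    _ ≤ |M| * gaussVortexProfile y :=
        mul_le_mul_of_nonneg_right (le_abs_self M) (gaussVortexProfile_pos y).le
    _ ≤ |M| * (4 * Real.pi)⁻¹ := mul_le_mul_of_nonneg_left (gaussVortexProfile_le y) (abs_nonneg M)

/-- Uniform bound for the absolutely convergent Biot–Savart integral of a bounded integrable density:
`∫ ‖w(η) K(ξ − η)‖ dη ≤ (2π)⁻¹ (A ∫ 𝟙_{‖z‖<1}‖z‖⁻¹ dz + ‖w‖₁)` for `|w| ≤ A`. [folklore] -/
theorem integral_norm_smul_biotSavartKernel2D_le {w : EuclideanSpace ℝ (Fin 2) → ℝ} {A : ℝ}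
    (hwi : Integrable w) (hA : ∀ y, |w y| ≤ A)
    (hK : ∀ x, Integrable (fun y => w y • biotSavartKernel2D (x - y))) (x : EuclideanSpace ℝ (Fin 2)) :
    ∫ y, ‖w y • biotSavartKernel2D (x - y)‖ ≤ (2 * Real.pi)⁻¹ *
      (A * (∫ z, Set.indicator (Metric.ball (0 : EuclideanSpace ℝ (Fin 2)) 1) (fun z => ‖z‖⁻¹) z) +
        ∫ y, |w y|) := by
  have hI : Integrable fun y => Set.indicator (Metric.ball (0 : EuclideanSpace ℝ (Fin 2)) 1)
      (fun z => ‖z‖⁻¹) (x - y) := integrable_indicator_inv_norm.comp_sub_left x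
  have hint : Integrable fun y => (2 * Real.pi)⁻¹ *
      (A * Set.indicator (Metric.ball (0 : EuclideanSpace ℝ (Fin 2)) 1) (fun z => ‖z‖⁻¹) (x - y) +
        |w y|) := ((hI.const_mul A).add hwi.abs).const_mul _
  calc ∫ y, ‖w y • biotSavartKernel2D (x - y)‖
      ≤ ∫ y, (2 * Real.pi)⁻¹ *
          (A * Set.indicator (Metric.ball (0 : EuclideanSpace ℝ (Fin 2)) 1) (fun z => ‖z‖⁻¹) (x - y) +
            |w y|) := integral_mono (hK x).norm hint (fun y => norm_biotSavart_integrand_le hA x y)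
    _ = (2 * Real.pi)⁻¹ *
          (A * (∫ z, Set.indicator (Metric.ball (0 : EuclideanSpace ℝ (Fin 2)) 1) (fun z => ‖z‖⁻¹) z) +
            ∫ y, |w y|) := by
        rw [integral_const_mul, integral_add (hI.const_mul A) hwi.abs, integral_const_mul,
          integral_sub_left_eq_self
            (Set.indicator (Metric.ball (0 : EuclideanSpace ℝ (Fin 2)) 1) fun z => ‖z‖⁻¹) volume x]

/-- H2: the Biot–Savart part of `Λ_G` is skew in `L²(G⁻¹)`: `∫ G⁻¹ w ⟪K∗w, ∇G⟫ = −½ ∫ w ⟪ξ, K∗w⟫ = 0`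
for continuous integrable `w` with a Gaussian bound (antisymmetry `x·K(x) = 0`, oddness of `K`, and Fubini).
[cite: GallayWayne2005, Lemma 4.8] -/
theorem coreBiotSavart_skew :
    ∀ w : EuclideanSpace ℝ (Fin 2) → ℝ, Continuous w → Integrable w →
      (∃ M : ℝ, ∀ ξ, |w ξ| ≤ M * gaussVortexProfile ξ) →
      ∫ ξ, (gaussVortexProfile ξ)⁻¹ * w ξ * ⟪biotSavart2D w ξ, gradient gaussVortexProfile ξ⟫ = 0 := by
  intro w hw hwi hM
  obtain ⟨M, hM⟩ := hM
  have hA : ∀ y, |w y| ≤ |M| * (4 * Real.pi)⁻¹ := abs_le_of_abs_le_mul_gaussVortexProfile hM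
  have hK : ∀ x, Integrable (fun y => w y • biotSavartKernel2D (x - y)) :=
    integrable_smul_biotSavartKernel2D hwi hA
  -- Step 1: `⟪v, ∇G(ξ)⟫ = -(G ξ/2) ⟪ξ, v⟫`, so the integrand is `-(1/2) w ξ ⟪ξ, (K∗w) ξ⟫`.
  have hpt : ∀ ξ, (gaussVortexProfile ξ)⁻¹ * w ξ * ⟪biotSavart2D w ξ, gradient gaussVortexProfile ξ⟫ =
      -(1 / 2) * (w ξ * ⟪ξ, biotSavart2D w ξ⟫) := by
    intro ξ
    have hG : gaussVortexProfile ξ ≠ 0 := (gaussVortexProfile_pos ξ).ne'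
    rw [real_inner_comm (gradient gaussVortexProfile ξ), gradient,
      InnerProductSpace.toDual_symm_apply, fderiv_gaussVortexProfile_apply]
    field_simp
  simp_rw [hpt]
  rw [integral_const_mul]
  -- Step 2: the double integral `J = ∫ ξ, ∫ η, F ξ η`.
  set F : EuclideanSpace ℝ (Fin 2) → EuclideanSpace ℝ (Fin 2) → ℝ :=
    fun ξ η => w ξ * ⟪ξ, w η • biotSavartKernel2D (ξ - η)⟫ with hF
  have hJ : ∀ ξ, w ξ * ⟪ξ, biotSavart2D w ξ⟫ = ∫ η, F ξ η := by
    intro ξ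
    rw [hF, biotSavart2D, ← integral_inner (hK ξ), ← integral_const_mul]
  simp_rw [hJ]
  -- Step 3: antisymmetry of `F`.
  have hanti : ∀ ξ η, F η ξ = -F ξ η := by
    intro ξ η
    simp only [hF, inner_smul_right, inner_biotSavartKernel2D_swap ξ η]
    ring
  -- Step 4: `F` is integrable on the product.
  have hmeas : AEStronglyMeasurable (uncurry F)
      ((volume : Measure (EuclideanSpace ℝ (Fin 2))).prod volume) := by
    have h1 : Measurable fun p : EuclideanSpace ℝ (Fin 2) × EuclideanSpace ℝ (Fin 2) =>
        w p.2 • biotSavartKernel2D (p.1 - p.2) :=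
      (hw.measurable.comp measurable_snd).smul
        (measurable_biotSavartKernel2D.comp (measurable_fst.sub measurable_snd))
    exact ((hw.measurable.comp measurable_fst).mul (measurable_fst.inner h1)).aestronglyMeasurable
  set C : ℝ := (2 * Real.pi)⁻¹ *
      (|M| * (4 * Real.pi)⁻¹ *
        (∫ z, Set.indicator (Metric.ball (0 : EuclideanSpace ℝ (Fin 2)) 1) (fun z => ‖z‖⁻¹) z) +
        ∫ y, |w y|) with hC
  have hC0 : 0 ≤ C := by
    have h1 : 0 ≤ ∫ z, Set.indicator (Metric.ball (0 : EuclideanSpace ℝ (Fin 2)) 1) (fun z => ‖z‖⁻¹) z :=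
      integral_nonneg indicator_inv_norm_nonneg
    have h2 : 0 ≤ ∫ y, |w y| := integral_nonneg fun y => abs_nonneg _
    positivity
  have hrow : ∀ ξ, Integrable (F ξ) := fun ξ => ((hK ξ).const_inner ξ).const_mul (w ξ)
  have hrowbd : ∀ ξ, ∫ η, ‖F ξ η‖ ≤ |w ξ| * ‖ξ‖ * C := by
    intro ξ
    calc ∫ η, ‖F ξ η‖ ≤ ∫ η, |w ξ| * ‖ξ‖ * ‖w η • biotSavartKernel2D (ξ - η)‖ := by
          refine integral_mono (hrow ξ).norm (((hK ξ).norm).const_mul _) fun η => ?_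
          simp only [hF]
          rw [norm_mul, Real.norm_eq_abs, mul_assoc]
          exact mul_le_mul_of_nonneg_left (abs_real_inner_le_norm _ _) (abs_nonneg _)
      _ = |w ξ| * ‖ξ‖ * ∫ η, ‖w η • biotSavartKernel2D (ξ - η)‖ := integral_const_mul _ _
      _ ≤ |w ξ| * ‖ξ‖ * C :=
          mul_le_mul_of_nonneg_left (integral_norm_smul_biotSavartKernel2D_le hwi hA hK ξ)
            (by positivity)
  have hmom : Integrable fun ξ : EuclideanSpace ℝ (Fin 2) => |M| * C * (gaussVortexProfile ξ * ‖ξ‖) := by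
    rw [gaussVortexProfile_eq_heatKernel]
    exact (Literature.Analysis.UnboundedOperators.integrable_heatKernel_mul_norm one_pos).const_mul _
  have hFi : Integrable (uncurry F) ((volume : Measure (EuclideanSpace ℝ (Fin 2))).prod volume) := by
    rw [integrable_prod_iff hmeas]
    refine ⟨Eventually.of_forall fun ξ => hrow ξ, ?_⟩
    refine hmom.mono' hmeas.norm.integral_prod_right' (Eventually.of_forall fun ξ => ?_)
    rw [Real.norm_of_nonneg (integral_nonneg fun η => norm_nonneg _)]
    calc ∫ η, ‖uncurry F (ξ, η)‖ = ∫ η, ‖F ξ η‖ := rfl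
      _ ≤ |w ξ| * ‖ξ‖ * C := hrowbd ξ
      _ ≤ |M| * gaussVortexProfile ξ * ‖ξ‖ * C := by
          have h1 : |w ξ| ≤ |M| * gaussVortexProfile ξ :=
            (hM ξ).trans (mul_le_mul_of_nonneg_right (le_abs_self M) (gaussVortexProfile_pos ξ).le)
          gcongr
      _ = |M| * C * (gaussVortexProfile ξ * ‖ξ‖) := by ring
  -- Step 5: Fubini and antisymmetry give `J = -J`.
  have hswap := integral_integral_swap hFi
  have hneg : ∀ η, ∫ ξ, F ξ η = -∫ ξ, F η ξ := by
    intro η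
    rw [← integral_neg]
    exact integral_congr_ae (Eventually.of_forall fun ξ => hanti η ξ)
  simp_rw [hneg, integral_neg] at hswap
  have hJ0 : ∫ ξ, ∫ η, F ξ η = 0 := by linarith
  rw [hJ0, mul_zero]

end Summit.AnomalousDissipation.AnomalousDissipation.Theorems.MarginalStabilityChainStretchedVortexRows

end
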